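import Summits.CriticalPhenomena.SAWScalingLimit.Theses.SAWPoissonBanks
import Literature.Probability.RandomPlanarGeometry.SAWSideProbability
import HarnessLib.Audit

/-!
# Crux `PoissonianBanks` (stmt-CriticalPhenomena-4776) — birth skeleton `Lines/birth.lean`

Route `SAWPoissonBanks` (route-CriticalPhenomena-SAWPoissonBanks), crux BY NAME:
`Summit.CriticalPhenomena.SAWScalingLimit.Theses.SAWPoissonBanks.PoissonianBanks` — for the critical
`δℤ²` SAW in a Dobrushin domain `(D; a, b)`, a side `j`, a base sub-domain `B` and hull-complements
`F₀, …, F_n` of `D` on side `j`, the one-sided avoidance probabilities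
`q_δ(S) = law_δ(range ⊆ cl B ∩ ⋂_{i ∈ S} cl F_i)` satisfy Matheron's complete-alternation tower
ASYMPTOTICALLY: `∀ ε > 0, ∀ᶠ δ → 0⁺, ∏_{|S| odd} q_δ(S) ≤ ∏_{|S| even} q_δ(S) + ε`.

## The line: generator form of the banks (Matheron ⟸ Poisson) + compactness

Matheron's theorem (Molchanov2017 Ch. 4 Thm 1.6; Werner2005ConformalRestriction Thm 8 for the SLE_{8/3}
bank) says a random closed set is union-infinitely-divisible — the fill of a Poisson germ process with a
σ-finite intensity ("generator", Lévy measure) `ν` — iff `Ψ = −log(avoidance)` is completely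
alternating, and THEN `Ψ(K) = ν{germs hitting K}`.  The tower in `PoissonianBanks` is the inequality
half of this picture; the line makes the GENERATOR the object:

* `stub_subseqBankGenerator` (G, load-bearing, the transfer `C⁺`): along every mesh sequence
  `δ_k → 0⁺`, every limit `q` of the joint avoidance data `(q_{δ_k}(S))_S` is a Poisson germ-fill
  avoidance function with ONE generator for ALL hull families at once: there is a measure `ν` on
  `CurveClass ℂ` (germs realised as curves — Werner's Brownian excursions hanging off `D.arc j`,
  "germ enters the hull `D ∖ F_i`" = `range ⊄ cl F_i`), depending on `(D, a, b, j, B)` and the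
  sequence but NOT on the hull family, with `q(S) = q(∅) · exp(−ν(⋃_{i∈S} {range ⊄ cl F_i}))`.
  Strictly stronger than the tower (coherence of the generator across families = σ-additivity of the
  Lévy measure, the hard half of Matheron); it is the form in which the route's next crux
  `PoissonRigidity` consumes the banks (restriction = Poisson thinning of ONE `ν_D`), and it is
  attackable by a two-model comparison with an EXPLICIT lattice candidate, the `(5/8)·c₀⁻¹`-multiple
  of the random-walk excursion measure of `B_δ` off `arc j` (LSW restriction exponent `5/8`;
  route item `MutualAvoidanceLaw` is its order-2 shadow).  OPEN (XL).
* `stub_unionCapacityAlternating` (M, Matheron's easy half, pure measure theory): for any measure `ν`,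
  measurable sets `A₀, …, A_n` of finite mass and any constant `c`,
  `∏_{|S| odd} c·exp(−ν(⋃_{i∈S} A_i)) ≤ ∏_{|S| even} c·exp(−ν(⋃_{i∈S} A_i))` — the union-capacity
  of a measure is completely alternating (pointwise: for `T = {i : ω ∈ A_i}`, the number of even
  `S` meeting `T` is at most the number of odd `S` meeting `T`; integrate).  M-sized, certainly true.

`PoissonianBanks_of (hG) (hM) : PoissonianBanks` is PROVED below (no sorry): if the asymptotic tower
failed for some `ε > 0`, it would fail along a sequence `δ_k → 0⁺` (`𝓝[>] 0` is countably generated);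
the avoidance vectors live in the compact metrisable space `Finset (Fin (n+1)) → ℝ≥0∞`, so a
subsequence converges to some `q`; by (G) `q(S) = q(∅)·exp(−ν(⋃_S A_i))`, by (M) the EXACT tower holds
for `q`, and continuity of finite products of `[0,1]`-valued sequences (`ENNReal.tendsto_finsetProd_of_ne_top`)
contradicts the `ε`-violation.  The abstract step is `eventually_prod_le_prod_add_of_subseqLimits`.

Sorries: exactly 2 = the two `stub_*`; zero elsewhere.  Disproof used: none (no `Disproof.lean` on this
crux: `ledger crux ls stmt-CriticalPhenomena-4776` → no workfiles, 2026-08-17).  Negatives honoured: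
stmt-0772 (all-`δ` tightness) is not used; every lattice statement here is along `δ → 0⁺`.
BC3 probes (planner folder `bc/probe_*.lean`): `stub → PoissonianBanks` and `stub → SAWScalingLimit` by
`first | exact? | simpa | aesop` FAIL for both stubs (see `Lines/birth.md`).
-/

noncomputable section

open MeasureTheory Filter Topology Set Function
open Literature.Probability.RandomPlanarGeometry Literature.Probability.RandomPlanarGeometry.SAW
open Literature.Probability.LatticeModels
open scoped ENNReal NNReal MeasureTheory Topology

namespace Summit.CriticalPhenomena.SAWScalingLimit.Cruxes.PoissonianBanks.Birth

open Summit.CriticalPhenomena.SAWScalingLimit.Theses.SAWPoissonBanks (PoissonianBanks)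

/-! ## The registered stubs -/

/-- **stub (G) — SUBSEQUENTIAL BANK GENERATOR** (transfer `C⁺` of the crux; new).  For every
Dobrushin domain `D`, endpoint approximation `(a, b)`, side `j`, base hull-complement `B` of `D` on side
`j`, and every mesh sequence `s k → 0⁺`, there is ONE measure `ν` on `CurveClass ℂ` (the generator of
the side-`j` bank along `s`, germs realised as curves) such that for EVERY family `F₀, …, F_n` of
hull-complements of `D` on side `j`: the exit events `{range ⊄ cl F_i}` have finite `ν`-mass, and
whenever the joint avoidance data `k ↦ (law_{s k}(range ⊆ cl B ∩ ⋂_{i∈S} cl F_i))_S` converges to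
`q`, then `q(S) = q(∅) · exp(−ν(⋃_{i∈S} {range ⊄ cl F_i}))` for all `S`.  In the conjectured world
`ν = (5/8)·μ^{exc}_{B, arc j}` (Brownian excursion measure) by restriction + Werner's Poisson
representation of one-sided restriction samples; the lattice candidate is `(5/8)c₀⁻¹·`(random-walk
excursion measure).  Why it might fail: like the crux — a persistent higher-order alternation defect, or
union-divisible limits whose generators are NOT coherent across hull families.
Sources: Werner2005ConformalRestriction §4.3 Thm 8, §4.4; Molchanov2017 Ch. 4 Thm 1.6;
LawlerSchrammWerner2004SAW §3.4.5; LawlerSchrammWerner2003Restriction. -/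
theorem stub_subseqBankGenerator : ∀ (D : Literature.Probability.RandomPlanarGeometry.DobrushinDomain) (a b : ℝ → Literature.Probability.LatticeModels.Site 2), Literature.Probability.RandomPlanarGeometry.SAW.IsEndpointApprox D a b → ∀ (j : Fin 2) (B : Literature.Probability.RandomPlanarGeometry.DobrushinDomain), (B.carrier ⊆ D.carrier ∧ B.pt 0 = D.pt 0 ∧ B.pt 1 = D.pt 1 ∧ D.arc j ⊆ frontier B.carrier ∧ (∃ ε : ℝ, 0 < ε ∧ B.carrier ∩ Metric.ball (D.pt 0) ε = D.carrier ∩ Metric.ball (D.pt 0) ε ∧ B.carrier ∩ Metric.ball (D.pt 1) ε = D.carrier ∩ Metric.ball (D.pt 1) ε)) → ∀ (s : ℕ → ℝ), Filter.Tendsto s Filter.atTop (nhdsWithin (0 : ℝ) (Set.Ioi 0)) → ∃ ν : MeasureTheory.Measure (Literature.Probability.RandomPlanarGeometry.CurveClass ℂ), ∀ (n : ℕ) (F : Fin (n + 1) → Literature.Probability.RandomPlanarGeometry.DobrushinDomain), (∀ i, ((F i).carrier ⊆ D.carrier ∧ (F i).pt 0 = D.pt 0 ∧ (F i).pt 1 =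 D.pt 1 ∧ D.arc j ⊆ frontier (F i).carrier ∧ (∃ ε : ℝ, 0 < ε ∧ (F i).carrier ∩ Metric.ball (D.pt 0) ε = D.carrier ∩ Metric.ball (D.pt 0) ε ∧ (F i).carrier ∩ Metric.ball (D.pt 1) ε = D.carrier ∩ Metric.ball (D.pt 1) ε))) → (∀ i : Fin (n + 1), ν ((Literature.Probability.RandomPlanarGeometry.CurveClass.rangeSubset (closure (F i).carrier))ᶜ) ≠ ⊤) ∧ ∀ q : Finset (Fin (n + 1)) → ENNReal, (∀ S : Finset (Fin (n + 1)), Filter.Tendsto (fun k => ((Literature.Probability.RandomPlanarGeometry.SAW.law D.carrier (s k) (a (s k)) (b (s k))).map (fun γ => γ.curve)) (Literature.Probability.RandomPlanarGeometry.CurveClass.rangeSubset (closure B.carrier) ∩ ⋂ i ∈ S, Literature.Probability.RandomPlanarGeometry.CurveClass.rangeSubset (closure (F i).carrier))) Filter.atTop (nhds (q S))) → ∀ S : Finset (Fin (n + 1)), q S = q ∅ * ENNReal.ofReal (Real.exp (-(ν (⋃ i ∈ S, (Literature.Probability.RandomPlanarGeometry.CurveClass.rangeSubset (closure (F i).carrier))ᶜ)).toReal))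 := by
  sorry

/-- **stub (M) — UNION-CAPACITIES OF MEASURES ARE COMPLETELY ALTERNATING** (Matheron's easy half;
pure measure theory, M-sized).  For a measure `ν` on any measurable space, measurable sets
`A₀, …, A_n` of finite mass and a constant `c ∈ [0, ∞]`, the Poisson germ-fill avoidance numbers
`S ↦ c · exp(−ν(⋃_{i∈S} A_i))` satisfy the order-`(n+1)` alternation inequality
`∏_{|S| odd} ≤ ∏_{|S| even}` (products over all `S ⊆ Fin (n+1)`; `#odd = #even`, so `c` cancels).
Proof sketch: `Σ_{|S| even} ν(⋃_S A_i) ≤ Σ_{|S| odd} ν(⋃_S A_i)` because pointwise, with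
`T(ω) = {i : ω ∈ A_i}`, `#{S even : S ∩ T ≠ ∅} − #{S odd : S ∩ T ≠ ∅} = −[T = univ] ≤ 0`
(dual inclusion–exclusion: `Σ_{S ≠ ∅} (−1)^{|S|+1} ν(⋃_S A_i) = ν(⋂_i A_i) ≥ 0`).
Sources: Molchanov2017 Ch. 1 §1.2 (complete alternation of capacity functionals) and Ch. 4 Thm 1.6;
LastPenrose2017 (Poisson void probabilities). -/
theorem stub_unionCapacityAlternating : ∀ (α : Type) [MeasurableSpace α] (ν : MeasureTheory.Measure α) (n : ℕ) (A : Fin (n + 1) → Set α) (c : ENNReal), (∀ i, MeasurableSet (A i)) → (∀ i, ν (A i) ≠ ⊤) → (∏ S ∈ (Finset.univ : Finset (Finset (Fin (n + 1)))).filter (fun S => Odd S.card), c * ENNReal.ofReal (Real.exp (-(ν (⋃ i ∈ S, A i)).toReal))) ≤ (∏ S ∈ (Finset.univ : Finset (Finset (Fin (n + 1)))).filter (fun S => Even S.card), c * ENNReal.ofReal (Real.exp (-(ν (⋃ i ∈ S, A i)).toReal))) := by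
  sorry

/-! ## Name-keyed aliases of the stub statements (skeleton-check convention: the hypotheses of
`PoissonianBanks_of` are exactly the declared stubs, each BY NAME) -/

namespace Registered

/-- Alias keyed by the stub name: the statement of `stub_subseqBankGenerator`. -/
abbrev stub_subseqBankGenerator : Prop :=
  ∀ (D : Literature.Probability.RandomPlanarGeometry.DobrushinDomain) (a b : ℝ → Literature.Probability.LatticeModels.Site 2), Literature.Probability.RandomPlanarGeometry.SAW.IsEndpointApprox D a b → ∀ (j : Fin 2) (B : Literature.Probability.RandomPlanarGeometry.DobrushinDomain), (B.carrier ⊆ D.carrier ∧ B.pt 0 = D.pt 0 ∧ B.pt 1 = D.pt 1 ∧ D.arc j ⊆ frontier B.carrier ∧ (∃ ε : ℝ, 0 < ε ∧ B.carrier ∩ Metric.ball (D.pt 0) ε = D.carrier ∩ Metric.ball (D.pt 0) ε ∧ B.carrier ∩ Metric.ball (D.pt 1) ε = D.carrier ∩ Metric.ball (D.pt 1) ε)) → ∀ (s : ℕ → ℝ), Filter.Tendsto s Filter.atTop (nhdsWithin (0 : ℝ) (Set.Ioi 0)) → ∃ ν : MeasureTheory.Measure (Literature.Probability.RandomPlanarGeometry.CurveClass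 ℂ), ∀ (n : ℕ) (F : Fin (n + 1) → Literature.Probability.RandomPlanarGeometry.DobrushinDomain), (∀ i, ((F i).carrier ⊆ D.carrier ∧ (F i).pt 0 = D.pt 0 ∧ (F i).pt 1 = D.pt 1 ∧ D.arc j ⊆ frontier (F i).carrier ∧ (∃ ε : ℝ, 0 < ε ∧ (F i).carrier ∩ Metric.ball (D.pt 0) ε = D.carrier ∩ Metric.ball (D.pt 0) ε ∧ (F i).carrier ∩ Metric.ball (D.pt 1) ε = D.carrier ∩ Metric.ball (D.pt 1) ε))) → (∀ i : Fin (n + 1), ν ((Literature.Probability.RandomPlanarGeometry.CurveClass.rangeSubset (closure (F i).carrier))ᶜ) ≠ ⊤) ∧ ∀ q : Finset (Fin (n + 1)) → ENNReal, (∀ S : Finset (Fin (n + 1)), Filter.Tendsto (fun k => ((Literature.Probability.RandomPlanarGeometry.SAW.law D.carrier (s k) (a (s k)) (b (s k))).map (fun γ => γ.curve)) (Literature.Probability.RandomPlanarGeometry.CurveClass.rangeSubset (closure B.carrier) ∩ ⋂ i ∈ S, Literature.Probability.RandomPlanarGeometry.CurveClass.rangeSubset (closure (F i).carrier))) Filter.atTop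 (nhds (q S))) → ∀ S : Finset (Fin (n + 1)), q S = q ∅ * ENNReal.ofReal (Real.exp (-(ν (⋃ i ∈ S, (Literature.Probability.RandomPlanarGeometry.CurveClass.rangeSubset (closure (F i).carrier))ᶜ)).toReal))

/-- Alias keyed by the stub name: the statement of `stub_unionCapacityAlternating`. -/
abbrev stub_unionCapacityAlternating : Prop :=
  ∀ (α : Type) [MeasurableSpace α] (ν : MeasureTheory.Measure α) (n : ℕ) (A : Fin (n + 1) → Set α) (c : ENNReal), (∀ i, MeasurableSet (A i)) → (∀ i, ν (A i) ≠ ⊤) → (∏ S ∈ (Finset.univ : Finset (Finset (Fin (n + 1)))).filter (fun S => Odd S.card), c * ENNReal.ofReal (Real.exp (-(ν (⋃ i ∈ S, A i)).toReal))) ≤ (∏ S ∈ (Finset.univ : Finset (Finset (Fin (n + 1)))).filter (fun S => Even S.card), c * ENNReal.ofReal (Real.exp (-(ν (⋃ i ∈ S, A i)).toReal)))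

end Registered

/-! ## Proved glue -/

/-- The pushed-forward critical SAW law gives mass at most `1` to every event (the law is the
normalised weight, junk value `0` when no SAW joins the endpoints). [folklore] -/
theorem map_law_apply_le_one (Ω : Set ℂ) (δ : ℝ) (u v : Site 2) (T : Set (CurveClass ℂ)) :
    ((SAW.law Ω δ u v).map (fun γ => γ.curve)) T ≤ 1 := by
  calc ((SAW.law Ω δ u v).map (fun γ => γ.curve)) T
        ≤ ((SAW.law Ω δ u v).map (fun γ => γ.curve)) Set.univ := measure_mono (Set.subset_univ _)
    _ = SAW.law Ω δ u v Set.univ := by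
          rw [Measure.map_apply (SAW.DomainSAW.measurable_of_top _) MeasurableSet.univ, Set.preimage_univ]
    _ ≤ 1 := SAW.law_apply_le_one Ω δ u v _

/-- **Abstract compactness step.**  Let `v δ : N → ℝ≥0∞` (`N` finite) be `[0,1]`-valued data along
`δ → 0⁺`, and suppose that along every sequence `s k → 0⁺` for which the data converge, the limit `q`
satisfies `∏_{S ∈ O} q S ≤ ∏_{S ∈ E} q S`.  Then for every `ε > 0`, eventually along `δ → 0⁺`,
`∏_{S ∈ O} v δ S ≤ ∏_{S ∈ E} v δ S + ε`.  (Countable generation of `𝓝[>] 0`, sequential compactness of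
`N → ℝ≥0∞`, continuity of finite products at finite limits.) [folklore] -/
theorem eventually_prod_le_prod_add_of_subseqLimits {N : Type*} [Fintype N]
    (O E : Finset N) (v : ℝ → N → ℝ≥0∞) (hv : ∀ δ S, v δ S ≤ 1)
    (hlim : ∀ s : ℕ → ℝ, Tendsto s atTop (𝓝[>] (0 : ℝ)) → ∀ q : N → ℝ≥0∞,
      (∀ S, Tendsto (fun k => v (s k) S) atTop (𝓝 (q S))) → ∏ S ∈ O, q S ≤ ∏ S ∈ E, q S)
    {ε : ℝ≥0∞} (hε : 0 < ε) :
    ∀ᶠ δ in 𝓝[>] (0 : ℝ), ∏ S ∈ O, v δ S ≤ ∏ S ∈ E, v δ S + ε := by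
  by_contra h
  obtain ⟨s, hs, hbad⟩ := Filter.exists_seq_forall_of_frequently (Filter.not_eventually.1 h)
  -- sequential compactness of `N → ℝ≥0∞`
  obtain ⟨q, φ, hφ, hconv⟩ := CompactSpace.tendsto_subseq (fun k => v (s k))
  have hcoord : ∀ S, Tendsto (fun k => v (s (φ k)) S) atTop (𝓝 (q S)) := fun S =>
    (tendsto_pi_nhds.1 hconv) S
  have hq1 : ∀ S, q S ≠ ∞ := fun S =>
    ne_top_of_le_ne_top ENNReal.one_ne_top (le_of_tendsto' (hcoord S) fun k => hv _ _)
  have htower : ∏ S ∈ O, q S ≤ ∏ S ∈ E, q S :=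
    hlim (s ∘ φ) (hs.comp hφ.tendsto_atTop) q hcoord
  have hO : Tendsto (fun k => ∏ S ∈ O, v (s (φ k)) S) atTop (𝓝 (∏ S ∈ O, q S)) :=
    ENNReal.tendsto_finsetProd_of_ne_top O (fun S _ => hcoord S) (fun S _ => hq1 S)
  have hE : Tendsto (fun k => ∏ S ∈ E, v (s (φ k)) S + ε) atTop (𝓝 (∏ S ∈ E, q S + ε)) :=
    (ENNReal.tendsto_finsetProd_of_ne_top E (fun S _ => hcoord S) (fun S _ => hq1 S)).add
      tendsto_const_nhds
  have hle : ∏ S ∈ E, q S + ε ≤ ∏ S ∈ O, q S :=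
    le_of_tendsto_of_tendsto' hE hO fun k => (not_le.1 (hbad (φ k))).le
  have hfin : ∏ S ∈ E, q S ≠ ∞ := ENNReal.prod_ne_top fun S _ => hq1 S
  exact absurd (hle.trans htower) (not_le.2 (ENNReal.lt_add_right hfin hε.ne'))

/-- BC5-style sanity (inhabited in kind): the order-1 case `n = 0` of stub (M) — plain monotonicity
`c · e^{−ν A₀} ≤ c` — by direct computation: the index sets are `{{0}}` (odd) and `{∅}` (even), and the
empty union has mass `0`. [folklore] -/
example (α : Type) [MeasurableSpace α] (ν : Measure α) (A : Fin 1 → Set α) (c : ℝ≥0∞) :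
    (∏ S ∈ (Finset.univ : Finset (Finset (Fin 1))).filter (fun S => Odd S.card),
        c * ENNReal.ofReal (Real.exp (-(ν (⋃ i ∈ S, A i)).toReal))) ≤
      ∏ S ∈ (Finset.univ : Finset (Finset (Fin 1))).filter (fun S => Even S.card),
        c * ENNReal.ofReal (Real.exp (-(ν (⋃ i ∈ S, A i)).toReal)) := by
  have hodd : (Finset.univ : Finset (Finset (Fin 1))).filter (fun S => Odd S.card) = {{0}} := by
    decide
  have heven : (Finset.univ : Finset (Finset (Fin 1))).filter (fun S => Even S.card) = {∅} := by
    decide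
  rw [hodd, heven, Finset.prod_singleton, Finset.prod_singleton]
  have h1 : ENNReal.ofReal (Real.exp (-(ν (⋃ i ∈ ({0} : Finset (Fin 1)), A i)).toReal)) ≤ 1 :=
    ENNReal.ofReal_le_one.2 (Real.exp_le_one_iff.2 (neg_nonpos.2 ENNReal.toReal_nonneg))
  have h2 : ENNReal.ofReal (Real.exp (-(ν (⋃ i ∈ (∅ : Finset (Fin 1)), A i)).toReal)) = 1 := by
    simp
  rw [h2, mul_one]
  calc c * ENNReal.ofReal (Real.exp (-(ν (⋃ i ∈ ({0} : Finset (Fin 1)), A i)).toReal))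
        ≤ c * 1 := by gcongr
    _ = c := mul_one c

/-! ## The composition: the crux BY NAME from the two stubs -/

/-- **`PoissonianBanks` from (G) and (M).**  Fix the data of the crux and `ε > 0`; apply the abstract
compactness step to the avoidance vectors `v δ S = law_δ(range ⊆ cl B ∩ ⋂_{i∈S} cl F_i)` (all `≤ 1`).
Along a sequence `s k → 0⁺` with `v (s k) → q`, stub (G) gives a generator `ν` with
`q S = q ∅ · exp(−ν(⋃_{i∈S} {range ⊄ cl F_i}))`, the exit events being Borel (complements of the closed
events `rangeSubset (cl F_i)`) and of finite mass; stub (M) with `c = q ∅` is then exactly the tower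
`∏_{odd} q ≤ ∏_{even} q`. [cite: Molchanov2017, Ch. 4 Thm 1.6] -/
theorem PoissonianBanks_of (hG : Registered.stub_subseqBankGenerator)
    (hM : Registered.stub_unionCapacityAlternating) :
    Summit.CriticalPhenomena.SAWScalingLimit.Theses.SAWPoissonBanks.PoissonianBanks := by
  intro D a b hab j B n F hB hF ε hε
  have hmeas : ∀ i : Fin (n + 1),
      MeasurableSet (CurveClass.rangeSubset (closure (F i).carrier))ᶜ := fun i =>
    (CurveClass.measurableSet_rangeSubset isClosed_closure).compl
  refine eventually_prod_le_prod_add_of_subseqLimits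
    ((Finset.univ : Finset (Finset (Fin (n + 1)))).filter (fun S => Odd S.card))
    ((Finset.univ : Finset (Finset (Fin (n + 1)))).filter (fun S => Even S.card))
    (fun δ S => ((SAW.law D.carrier δ (a δ) (b δ)).map (fun γ => γ.curve))
      (CurveClass.rangeSubset (closure B.carrier) ∩
        ⋂ i ∈ S, CurveClass.rangeSubset (closure (F i).carrier)))
    (fun δ S => map_law_apply_le_one _ _ _ _ _) ?_ hε
  intro s hs q hq
  obtain ⟨ν, hν⟩ := hG D a b hab j B hB s hs
  obtain ⟨hfin, hgen⟩ := hν n F hF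
  have hqS : ∀ S : Finset (Fin (n + 1)), q S = q ∅ * ENNReal.ofReal (Real.exp
      (-(ν (⋃ i ∈ S, (CurveClass.rangeSubset (closure (F i).carrier))ᶜ)).toReal)) := hgen q hq
  calc ∏ S ∈ (Finset.univ : Finset (Finset (Fin (n + 1)))).filter (fun S => Odd S.card), q S
        = ∏ S ∈ (Finset.univ : Finset (Finset (Fin (n + 1)))).filter (fun S => Odd S.card),
            q ∅ * ENNReal.ofReal (Real.exp
              (-(ν (⋃ i ∈ S, (CurveClass.rangeSubset (closure (F i).carrier))ᶜ)).toReal)) :=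
          Finset.prod_congr rfl fun S _ => hqS S
    _ ≤ ∏ S ∈ (Finset.univ : Finset (Finset (Fin (n + 1)))).filter (fun S => Even S.card),
            q ∅ * ENNReal.ofReal (Real.exp
              (-(ν (⋃ i ∈ S, (CurveClass.rangeSubset (closure (F i).carrier))ᶜ)).toReal)) :=
          hM (CurveClass ℂ) ν n (fun i => (CurveClass.rangeSubset (closure (F i).carrier))ᶜ)
            (q ∅) hmeas hfin
    _ = ∏ S ∈ (Finset.univ : Finset (Finset (Fin (n + 1)))).filter (fun S => Even S.card), q S :=
          (Finset.prod_congr rfl fun S _ => hqS S).symm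

/-- Wiring check: the crux BY NAME from the two registered (sorried) stubs — shows the stub theorems
are exactly the hypotheses of `PoissonianBanks_of` (this declaration inherits their `sorry`,
nothing is claimed). -/
theorem PoissonianBanks_wiring :
    Summit.CriticalPhenomena.SAWScalingLimit.Theses.SAWPoissonBanks.PoissonianBanks :=
  PoissonianBanks_of stub_subseqBankGenerator stub_unionCapacityAlternating

end Summit.CriticalPhenomena.SAWScalingLimit.Cruxes.PoissonianBanks.Birth
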